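import Mathlib
import Literature.NumberTheory.LFunctions.Zhang2022.Section4PerronIntegrability
import Literature.NumberTheory.LFunctions.Zhang2022.Section5VerticalShift
import Literature.Analysis.Complex.RectangleCauchyFormula
import HarnessLib

/-!
# Zhang (2022), §4 Lemma 4.4 (proof): "we move the contour of integration to the vertical
# segments … and to the two connecting horizontal segments" — the contour shifts for (4.7) and
# (4.8) (typed nodes `Section4.Shift47`, `Section4.Shift48`) DISCHARGED

Topic `Literature/NumberTheory/LFunctions/Zhang2022` (Landau–Siegel audit tree; verdict-neutral).
Y. Zhang, *Discrete mean estimates and the Landau–Siegel zero*, arXiv:2211.02515v1 (2022)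
[Zhang2022LandauSiegel] — **an unrefereed manuscript under adjudication.** [Z22 p.20, tex L1084–L1104]:

> To prove (4.7) we move the contour of integration to the vertical segments `w = 10 + iv` with
> `|v| < 𝓛²⁰`, `w = −σ−1/2 + iv` with `|v| ≥ 𝓛²⁰`, and to the two connecting horizontal segments
> `w = u ± i𝓛²⁰` with `−σ−1/2 ≤ u ≤ 10`. By a trivial bound for `ω₁(w)`, (4.5) and the residue
> theorem we obtain (4.7). To prove (4.8) we move the contour of integration to the vertical
> segments `w = −α + iv` … and to the two connecting horizontal segments …

The typed nodes assert the two contour IDENTITIES (`perronLine = perronContour − residue`, resp.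
`= perronContour`). Kernel content:

* `perronLine_eq_contour_sub` — for a Perron integrand `F(w) = f(w)P^{(9/5)w}ω₁(w)/w` with
  `g = fP^{(9/5)w}ω₁` holomorphic on the closed rectangle `[a,b]×[−V,V]`, `a < 0 < b`, and
  `v ↦ F(a+iv)` integrable: `(2π)⁻¹∫_ℝ F(a+iv)dv = perronContour − f(0)` (the tree's rectangle
  Cauchy formula `Literature.Analysis.Complex.integral_boundary_rect_div_sub_eq`; residue
  `g(0) = f(0)` as `P⁰ = ω₁(0) = 1`);
* `perronLine_eq_contour` — the same without a pole (`F` holomorphic on the closed rectangle,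
  Cauchy–Goursat);
* `differentiableAt_tildeZW` — `Z̃(·,ψ)` is holomorphic on the upper half-plane, and on the shifted
  rectangles `Im(s+w) ≥ Im s − 𝓛²⁰ > 0`;
* `shift47_holds : Shift47`, `shift48_holds : Shift48` — unconditional (threshold `D ≥ ⌈e³⌉`
  and the integrability threshold of `Section4PerronIntegrability`).

Nothing about Theorems 1–2 of the source or about Landau–Siegel zeros is stated or implied.

## References

* Y. Zhang, arXiv:2211.02515v1 (2022), §4 p. 20 (proof of Lemma 4.4, (4.7)–(4.8)).
  [cite: Zhang2022LandauSiegel, §4 Lemma 4.4 (proof)]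
-/

noncomputable section

open Complex Real ComplexConjugate MeasureTheory Set intervalIntegral
open scoped Interval

namespace Literature.NumberTheory.LFunctions.Zhang2022.Section4

open Skeleton

/-! ## The contour identities for a general Perron integrand -/

section General

variable {D : ℕ}

/-- Splitting the line integral at `±V`: `∫_ℝ F(a+iv)dv = ∫_{v≤−V} + ∫_{−V}^{V} + ∫_{v>V}`.
[cite: Zhang2022LandauSiegel, §4 Lemma 4.4 (proof) p. 20] -/
theorem integral_line_split (f : ℂ → ℂ) (a V : ℝ)
    (hint : Integrable fun v : ℝ => perronIntegrand D f (a + v * I)) :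
    ∫ v : ℝ, perronIntegrand D f (a + v * I)
      = (∫ v in Set.Iic (-V), perronIntegrand D f (a + v * I))
        + (∫ v in (-V)..V, perronIntegrand D f (a + v * I))
        + ∫ v in Set.Ioi V, perronIntegrand D f (a + v * I) := by
  rw [← intervalIntegral.integral_Iic_add_Ioi (b := -V) hint.integrableOn hint.integrableOn,
    ← intervalIntegral.integral_interval_add_Ioi (a := -V) (b := V) hint.integrableOn
      hint.integrableOn, add_assoc]

/-- `g(0) = f(0)`: `P^{(9/5)·0} = 1` and `ω₁(0) = 1`. [cite: Zhang2022LandauSiegel, §4 p. 20] -/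
theorem perron_numerator_zero (f : ℂ → ℂ) :
    f 0 * (bigP D : ℂ) ^ ((9 / 5 : ℂ) * 0) * omega1W D 0 = f 0 := by
  simp [omega1W, GaussWeight.omega1]

/-- **Contour shift across the pole at `w = 0`** ("by … the residue theorem"): if
`g(w) = f(w)P^{(9/5)w}ω₁(w)` is holomorphic on the closed rectangle `[a,b] × [−V,V]` with
`a < 0 < b`, `V > 0`, and `v ↦ F(a+iv)` is integrable (`F = g/w`), then
`(2π)⁻¹∫_ℝ F(a+iv)dv = perronContour(a,b,V) − f(0)`.
[cite: Zhang2022LandauSiegel, §4 Lemma 4.4 (proof) p. 20] -/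
theorem perronLine_eq_contour_sub (f : ℂ → ℂ) {a b V : ℝ} (ha : a < 0) (hb : 0 < b) (hV : 0 < V)
    (hg : DifferentiableOn ℂ (fun w => f w * (bigP D : ℂ) ^ ((9 / 5 : ℂ) * w) * omega1W D w)
      (Icc a b ×ℂ Icc (-V) V))
    (hint : Integrable fun v : ℝ => perronIntegrand D f (a + v * I)) :
    perronLine D f a = perronContour D f a b V - f 0 := by
  have hrect := Literature.Analysis.Complex.integral_boundary_rect_div_sub_eq
    (f := fun w => f w * (bigP D : ℂ) ^ ((9 / 5 : ℂ) * w) * omega1W D w) 0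
    (a := a) (b := b) (c := -V) (d := V) (by simpa using ha) (by simpa using hb)
    (by simpa using hV) (by simpa using hV) hg
  simp only [sub_zero, perron_numerator_zero] at hrect
  rw [perronLine, integral_line_split f a V hint, perronContour]
  -- name the six integrals
  set Lft : ℂ := ∫ v in (-V)..V, perronIntegrand D f (a + v * I) with hLft
  set Rgt : ℂ := ∫ v in (-V)..V, perronIntegrand D f (b + v * I) with hRgt
  set Bot : ℂ := ∫ u in a..b, perronIntegrand D f (u - V * I) with hBot
  set Top : ℂ := ∫ u in a..b, perronIntegrand D f (u + V * I) with hTop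
  set Ii : ℂ := ∫ v in Set.Iic (-V), perronIntegrand D f (a + v * I) with hIi
  set Io : ℂ := ∫ v in Set.Ioi V, perronIntegrand D f (a + v * I) with hIo
  have hBt' : (∫ x : ℝ in a..b, f (x + ↑(-V) * I) * (bigP D : ℂ) ^ ((9 / 5 : ℂ) * (x + ↑(-V) * I)) *
      omega1W D (x + ↑(-V) * I) / (x + ↑(-V) * I)) = Bot := by
    rw [hBot]
    refine intervalIntegral.integral_congr fun u _ => ?_
    simp only [perronIntegrand, Complex.ofReal_neg, neg_mul, ← sub_eq_add_neg]
  have hTp' : (∫ x : ℝ in a..b, f (x + V * I) * (bigP D : ℂ) ^ ((9 / 5 : ℂ) * (x + V * I)) *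
      omega1W D (x + V * I) / (x + V * I)) = Top := by
    rw [hTop]; rfl
  have hR' : (∫ y : ℝ in (-V)..V, f (b + y * I) * (bigP D : ℂ) ^ ((9 / 5 : ℂ) * (b + y * I)) *
      omega1W D (b + y * I) / (b + y * I)) = Rgt := by
    rw [hRgt]; rfl
  have hL' : (∫ y : ℝ in (-V)..V, f (a + y * I) * (bigP D : ℂ) ^ ((9 / 5 : ℂ) * (a + y * I)) *
      omega1W D (a + y * I) / (a + y * I)) = Lft := by
    rw [hLft]; rfl
  rw [hBt', hTp', hR', hL'] at hrect
  -- hrect : Bot - Top + I * Rgt - I * Lft = 2 * π * I * f 0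
  have hI : I * I = -1 := Complex.I_mul_I
  have hLval : Lft = Rgt - I * (Bot - Top) - 2 * π * f 0 := by
    linear_combination I * hrect + (Lft - Rgt + 2 * π * f 0) * hI
  have hπ : (π : ℂ) ≠ 0 := Complex.ofReal_ne_zero.mpr Real.pi_ne_zero
  have hinv : (1 / (2 * π * I) : ℂ) = -I / (2 * π) := by
    field_simp
    linear_combination hI
  rw [hLval, hinv]
  field_simp
  ring

/-- **Contour shift with no pole crossed**: if `F = fP^{(9/5)w}ω₁/w` is holomorphic on the closed
rectangle with opposite corners `a − iV`, `b + iV` (`V > 0`; `b` on either side of `a`) and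
`v ↦ F(a+iv)` is integrable, then `(2π)⁻¹∫_ℝ F(a+iv)dv = perronContour(a,b,V)` (Cauchy–Goursat).
[cite: Zhang2022LandauSiegel, §4 Lemma 4.4 (proof) p. 20] -/
theorem perronLine_eq_contour (f : ℂ → ℂ) {a b V : ℝ}
    (hF : DifferentiableOn ℂ (perronIntegrand D f) ([[a, b]] ×ℂ [[-V, V]]))
    (hint : Integrable fun v : ℝ => perronIntegrand D f (a + v * I)) :
    perronLine D f a = perronContour D f a b V := by
  have hrect := Complex.integral_boundary_rect_eq_zero_of_differentiableOn (perronIntegrand D f)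
    (Complex.mk a (-V)) (Complex.mk b V) (by simpa using hF)
  simp only [smul_eq_mul] at hrect
  rw [perronLine, integral_line_split f a V hint, perronContour]
  set Lft : ℂ := ∫ v in (-V)..V, perronIntegrand D f (a + v * I) with hLft
  set Rgt : ℂ := ∫ v in (-V)..V, perronIntegrand D f (b + v * I) with hRgt
  set Bot : ℂ := ∫ u in a..b, perronIntegrand D f (u - V * I) with hBot
  set Top : ℂ := ∫ u in a..b, perronIntegrand D f (u + V * I) with hTop
  set Ii : ℂ := ∫ v in Set.Iic (-V), perronIntegrand D f (a + v * I) with hIi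
  set Io : ℂ := ∫ v in Set.Ioi V, perronIntegrand D f (a + v * I) with hIo
  have hBt' : (∫ x : ℝ in a..b, perronIntegrand D f (x + ↑(-V) * I)) = Bot := by
    rw [hBot]
    refine intervalIntegral.integral_congr fun u _ => ?_
    simp only [Complex.ofReal_neg, neg_mul, ← sub_eq_add_neg]
  rw [hBt'] at hrect
  -- hrect : Bot - Top + I * Rgt - I * Lft = 0
  have hI : I * I = -1 := Complex.I_mul_I
  have hLval : Lft = Rgt - I * (Bot - Top) := by
    linear_combination I * hrect + (Lft - Rgt) * hI
  have hπ : (π : ℂ) ≠ 0 := Complex.ofReal_ne_zero.mpr Real.pi_ne_zero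
  have hinv : (1 / (2 * π * I) : ℂ) = -I / (2 * π) := by
    field_simp
    linear_combination hI
  rw [hLval, hinv]
  field_simp
  ring

end General

/-! ## Holomorphy of the integrands of (4.7), (4.8) on the shifted rectangles -/

section WithCharacter

variable {D : ℕ} [NeZero D] (χ : DirichletCharacter ℂ D) (x : Chr D)

/-- `Z̃(s + ·, ψ)` is holomorphic at `w` whenever `Im(s + w) > 0` (the tree's
`GammaFactor.differentiableAt_Zfac`). [cite: Zhang2022LandauSiegel, §4 (4.4)] -/
theorem differentiableAt_tildeZW_add (s w : ℂ) (hw : 0 < (s + w).im) :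
    DifferentiableAt ℂ (fun w => tildeZW χ x (s + w)) w := by
  have h1 : DifferentiableAt ℂ (GammaFactor.Zfac x.ψ) (s + w) :=
    GammaFactor.differentiableAt_Zfac x.ψ hw
  have h2 : DifferentiableAt ℂ (GammaFactor.Zfac (psiChi χ x)) (s + w) :=
    GammaFactor.differentiableAt_Zfac (psiChi χ x) hw
  have hadd : DifferentiableAt ℂ (fun w : ℂ => s + w) w := (differentiableAt_const s).add differentiableAt_id
  have h : (fun w => tildeZW χ x (s + w))
      = fun w => GammaFactor.Zfac x.ψ (s + w) * GammaFactor.Zfac (psiChi χ x) (s + w) := by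
    funext w; rw [tildeZW, GammaFactor.tildeZ_def]
  rw [h]
  exact (h1.comp w hadd).mul (h2.comp w hadd)

omit [NeZero D] in
/-- A finite Dirichlet polynomial `w ↦ Σ_{n∈S} c(n)n^{−(1−s−w)}` (`0 ∉ S`) is entire. [folklore] -/
private theorem differentiable_sum_cpow (S : Finset ℕ) (hS : 0 ∉ S) (c : ℕ → ℂ) (s : ℂ) :
    Differentiable ℂ fun w : ℂ => ∑ n ∈ S, c n * (n : ℂ) ^ (-(1 - s - w)) := by
  refine Differentiable.fun_sum fun n hn => ?_
  have hn0 : (n : ℂ) ≠ 0 := by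
    exact_mod_cast (Nat.pos_of_ne_zero fun h => hS (h ▸ hn)).ne'
  have he : Differentiable ℂ fun w : ℂ => -(1 - s - w) :=
    ((differentiable_const (1 - s)).sub differentiable_id).neg
  exact (he.const_cpow (Or.inl hn0)).const_mul _

omit [NeZero D] in
/-- The Perron numerator `w ↦ f(w)P^{(9/5)w}ω₁(w)` of §4 p. 19 is holomorphic where `f` is.
[cite: Zhang2022LandauSiegel, §4 Lemma 4.4 (proof) p. 19] -/
theorem differentiableAt_perronNumerator {f : ℂ → ℂ} {w : ℂ} (hf : DifferentiableAt ℂ f w) :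
    DifferentiableAt ℂ (fun w => f w * (bigP D : ℂ) ^ ((9 / 5 : ℂ) * w) * omega1W D w) w := by
  have hP : (bigP D : ℂ) ≠ 0 := by exact_mod_cast (Real.exp_pos _).ne'
  have h1 : DifferentiableAt ℂ (fun w : ℂ => (bigP D : ℂ) ^ ((9 / 5 : ℂ) * w)) w :=
    ((differentiableAt_const _).mul differentiableAt_id).const_cpow (Or.inl hP)
  have h2 : DifferentiableAt ℂ (omega1W D) w := by
    unfold omega1W GaussWeight.omega1
    exact ((differentiableAt_id.pow 2).div_const _).cexp
  exact (hf.mul h1).mul h2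

omit [NeZero D] in
/-- The Perron integrand `F = fP^{(9/5)w}ω₁/w` of §4 p. 19 is holomorphic at `w ≠ 0` where `f`
is. [cite: Zhang2022LandauSiegel, §4 Lemma 4.4 (proof) p. 19] -/
theorem differentiableAt_perronIntegrand {f : ℂ → ℂ} {w : ℂ} (hf : DifferentiableAt ℂ f w)
    (hw : w ≠ 0) : DifferentiableAt ℂ (perronIntegrand D f) w := by
  have h := (differentiableAt_perronNumerator (D := D) hf).div differentiableAt_id hw
  exact h

omit [NeZero D] in
/-- `𝓛 ≥ 3 ⇒` for `s ∈ Ω₃`: `Im s > 𝓛²⁰` (indeed `Im s > 2πt₀ − 𝓛₁ − 3`, `t₀ = 𝓛⁵¹⁹`), so the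
shifted rectangles `|Im w| ≤ 𝓛²⁰` stay in the upper half-plane `Im(s+w) > 0`.
[cite: Zhang2022LandauSiegel, §4 Lemma 4.4 (proof) p. 20] -/
theorem ell_pow_lt_im_of_mem_Omega3 (hL : 3 ≤ ell D) {s : ℂ} (hs : s ∈ Omega3 D) :
    ell D ^ 20 < s.im := by
  obtain ⟨-, -, h3⟩ := hs
  have h1 : 1 ≤ ell D := by linarith
  have ha : ell D ^ 405 ≤ ell D ^ 519 := pow_le_pow_right₀ h1 (by norm_num)
  have hb : ell D ^ 20 ≤ ell D ^ 519 := pow_le_pow_right₀ h1 (by norm_num)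
  have hc : (3 : ℝ) ≤ ell D ^ 519 := le_trans hL (le_self_pow₀ h1 (by norm_num))
  have hπ : (3 : ℝ) < π := Real.pi_gt_three
  rw [ell1, t0] at h3
  have := (abs_lt.mp h3).1
  nlinarith

/-- `f47 = Z̃(s+·)F(1−s−·,ψ̄)` is holomorphic at `w` when `Im(s+w) > 0`.
[cite: Zhang2022LandauSiegel, §4 (4.7)] -/
theorem differentiableAt_f47 (s w : ℂ) (hw : 0 < (s + w).im) :
    DifferentiableAt ℂ (f47 χ x s) w := by
  have hF : Differentiable ℂ fun w : ℂ => FpolyBar χ x (1 - s - w) := by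
    simpa [FpolyBar] using differentiable_sum_cpow (Finset.Icc 1 (D ^ 4)) (by simp)
      (fun n => nu χ n * conj (x.ψ (n : ZMod x.p))) s
  exact (differentiableAt_tildeZW_add χ x s w hw).mul (hF w)

/-- `f48 = Z̃(s+·)·Σ_{D⁴<n≤P²}ν(n)ψ̄(n)n^{−(1−s−·)}` is holomorphic at `w` when `Im(s+w) > 0`.
[cite: Zhang2022LandauSiegel, §4 (4.8)] -/
theorem differentiableAt_f48 (s w : ℂ) (hw : 0 < (s + w).im) :
    DifferentiableAt ℂ (f48 χ x s) w := by
  have hF : Differentiable ℂ fun w : ℂ => midSum χ x (1 - s - w) := by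
    simpa [midSum] using differentiable_sum_cpow (Finset.Ioc (D ^ 4) ⌊bigP D ^ 2⌋₊) (by simp)
      (fun n => nu χ n * psiBarFn x n) s
  exact (differentiableAt_tildeZW_add χ x s w hw).mul (hF w)

/-! ## Integrability on the line `Re w = −σ − 1/2` (as in `Section4ThreeWaySplit`) -/

/-- `|Z̃(s + a + iv)| ≤ C(1+|v|)²` on `Re(s+a) = −1/2`. [cite: Zhang2022LandauSiegel, §4 (4.5)] -/
private theorem norm_tildeZW_line_le {s : ℂ} {a : ℝ} (hca : (s + (a : ℂ)).re = -1 / 2) (v : ℝ) :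
    ‖tildeZW χ x (s + ((a : ℂ) + v * I))‖
      ≤ (‖GammaFactor.tau x.ψ‖ * (x.p : ℝ) ^ (1 / 2 : ℝ)) *
        (‖GammaFactor.tau (psiChi χ x)‖ * ((D * x.p : ℕ) : ℝ) ^ (1 / 2 : ℝ)) *
        (1 + ‖s + (a : ℂ)‖) ^ 2 * (1 + |v|) ^ 2 := by
  have hz : (s + ((a : ℂ) + v * I)).re = -1 / 2 := by
    rw [← add_assoc, Complex.add_re, hca]; simp
  have h1 := norm_tildeZW_le_of_re χ x hz
  have hn : ‖s + ((a : ℂ) + v * I)‖ ≤ ‖s + (a : ℂ)‖ + |v| := by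
    calc ‖s + ((a : ℂ) + v * I)‖ = ‖(s + (a : ℂ)) + v * I‖ := by rw [add_assoc]
      _ ≤ ‖s + (a : ℂ)‖ + ‖(v : ℂ) * I‖ := norm_add_le _ _
      _ = ‖s + (a : ℂ)‖ + |v| := by simp
  have h0 : 0 ≤ (‖GammaFactor.tau x.ψ‖ * (x.p : ℝ) ^ (1 / 2 : ℝ)) *
      (‖GammaFactor.tau (psiChi χ x)‖ * ((D * x.p : ℕ) : ℝ) ^ (1 / 2 : ℝ)) := by positivity
  calc ‖tildeZW χ x (s + ((a : ℂ) + v * I))‖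
      ≤ _ * (1 + ‖s + ((a : ℂ) + v * I)‖) ^ 2 := h1
    _ ≤ (‖GammaFactor.tau x.ψ‖ * (x.p : ℝ) ^ (1 / 2 : ℝ)) *
        (‖GammaFactor.tau (psiChi χ x)‖ * ((D * x.p : ℕ) : ℝ) ^ (1 / 2 : ℝ)) *
        ((1 + ‖s + (a : ℂ)‖) * (1 + |v|)) ^ 2 := by
        gcongr
        nlinarith [norm_nonneg (s + (a : ℂ)), abs_nonneg v]
    _ = _ := by ring

/-- **The (4.7)-integrand is integrable along `Re w = −σ − 1/2`** (`s ∈ Ω₃`, `𝓛 > 0`).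
[cite: Zhang2022LandauSiegel, §4 (4.7)] -/
theorem integrable_perronIntegrand_f47 (hL : 0 < ell D) {s : ℂ} (hs : s ∈ Omega3 D)
    (hα : alpha D < 1 / 2) :
    Integrable fun v : ℝ => perronIntegrand D (f47 χ x s) (((-s.re - 1 / 2 : ℝ) : ℂ) + v * I) := by
  set a : ℝ := -s.re - 1 / 2 with ha_def
  have hs1 : 1 / 2 - alpha D < s.re := hs.1
  have ha0 : a ≠ 0 := by rw [ha_def]; linarith
  have hca : (s + (a : ℂ)).re = -1 / 2 := by simp [ha_def]; ring
  have hz' : ∀ v : ℝ, (1 - s - ((a : ℂ) + v * I)).re = 3 / 2 := fun v => by simp [ha_def]; ring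
  have hZc : Continuous fun v : ℝ => tildeZW χ x (s + ((a : ℂ) + v * I)) := by
    simpa [add_assoc] using continuous_tildeZW_line χ x hca
  have hc : Continuous fun v : ℝ => f47 χ x s ((a : ℂ) + v * I) := by
    have hF : Continuous fun v : ℝ => FpolyBar χ x (1 - s - ((a : ℂ) + v * I)) := by
      simpa [FpolyBar] using continuous_sum_cpow_line (Finset.Icc 1 (D ^ 4)) (by simp)
        (fun n => nu χ n * conj (x.ψ (n : ZMod x.p))) s a
    exact hZc.mul hF
  refine integrable_perronIntegrand ha0 hc (A := (‖GammaFactor.tau x.ψ‖ * (x.p : ℝ) ^ (1 / 2 : ℝ)) *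
      (‖GammaFactor.tau (psiChi χ x)‖ * ((D * x.p : ℕ) : ℝ) ^ (1 / 2 : ℝ)) *
      (1 + ‖s + (a : ℂ)‖) ^ 2 * ∑ n ∈ Finset.Icc 1 (D ^ 4), ‖nu χ n‖) (fun v => ?_) hL
  rw [f47, norm_mul]
  have hF := norm_FpolyBar_le_sum_norm χ x (z := 1 - s - ((a : ℂ) + v * I)) (by rw [hz' v]; norm_num)
  calc ‖tildeZW χ x (s + ((a : ℂ) + v * I))‖ * ‖FpolyBar χ x (1 - s - ((a : ℂ) + v * I))‖
      ≤ (_ * (1 + |v|) ^ 2) * ∑ n ∈ Finset.Icc 1 (D ^ 4), ‖nu χ n‖ :=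
        mul_le_mul (norm_tildeZW_line_le χ x hca v) hF (norm_nonneg _) (by positivity)
    _ = _ := by ring

/-- **The (4.8)-integrand is integrable along `Re w = −σ − 1/2`** (`s ∈ Ω₃`, `𝓛 > 0`).
[cite: Zhang2022LandauSiegel, §4 (4.8)] -/
theorem integrable_perronIntegrand_f48 (hL : 0 < ell D) {s : ℂ} (hs : s ∈ Omega3 D)
    (hα : alpha D < 1 / 2) :
    Integrable fun v : ℝ => perronIntegrand D (f48 χ x s) (((-s.re - 1 / 2 : ℝ) : ℂ) + v * I) := by
  set a : ℝ := -s.re - 1 / 2 with ha_def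
  have hs1 : 1 / 2 - alpha D < s.re := hs.1
  have ha0 : a ≠ 0 := by rw [ha_def]; linarith
  have hca : (s + (a : ℂ)).re = -1 / 2 := by simp [ha_def]; ring
  have hz' : ∀ v : ℝ, (1 - s - ((a : ℂ) + v * I)).re = 3 / 2 := fun v => by simp [ha_def]; ring
  have hZc : Continuous fun v : ℝ => tildeZW χ x (s + ((a : ℂ) + v * I)) := by
    simpa [add_assoc] using continuous_tildeZW_line χ x hca
  have hc : Continuous fun v : ℝ => f48 χ x s ((a : ℂ) + v * I) := by
    have hF : Continuous fun v : ℝ => midSum χ x (1 - s - ((a : ℂ) + v * I)) := by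
      simpa [midSum] using continuous_sum_cpow_line (Finset.Ioc (D ^ 4) ⌊bigP D ^ 2⌋₊) (by simp)
        (fun n => nu χ n * psiBarFn x n) s a
    exact hZc.mul hF
  refine integrable_perronIntegrand ha0 hc (A := (‖GammaFactor.tau x.ψ‖ * (x.p : ℝ) ^ (1 / 2 : ℝ)) *
      (‖GammaFactor.tau (psiChi χ x)‖ * ((D * x.p : ℕ) : ℝ) ^ (1 / 2 : ℝ)) *
      (1 + ‖s + (a : ℂ)‖) ^ 2 * ∑ n ∈ Finset.Ioc (D ^ 4) ⌊bigP D ^ 2⌋₊, ‖nu χ n‖) (fun v => ?_) hL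
  rw [f48, norm_mul]
  have hF := norm_midSum_le_sum_norm χ x (z := 1 - s - ((a : ℂ) + v * I)) (by rw [hz' v]; norm_num)
  calc ‖tildeZW χ x (s + ((a : ℂ) + v * I))‖ * ‖midSum χ x (1 - s - ((a : ℂ) + v * I))‖
      ≤ (_ * (1 + |v|) ^ 2) * ∑ n ∈ Finset.Ioc (D ^ 4) ⌊bigP D ^ 2⌋₊, ‖nu χ n‖ :=
        mul_le_mul (norm_tildeZW_line_le χ x hca v) hF (norm_nonneg _) (by positivity)
    _ = _ := by ring

/-! ## `Section4.Shift47`, `Section4.Shift48` -/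

omit [NeZero D] in
/-- `⌈e³⌉ ≤ D` gives `3 ≤ 𝓛`. [folklore] -/
private theorem three_le_ell' {D : ℕ} (hD : ⌈Real.exp 3⌉₊ ≤ D) : 3 ≤ ell D := by
  have h : Real.exp 3 ≤ D := le_trans (Nat.le_ceil _) (by exact_mod_cast hD)
  exact (Real.le_log_iff_exp_le (lt_of_lt_of_le (Real.exp_pos _) h)).mpr h

omit [NeZero D] in
/-- `α = π/𝓛⁹ < 1/2` once `𝓛 ≥ 3`. [cite: Zhang2022LandauSiegel, §2 (2.10)] -/
private theorem alpha_lt_half' {D : ℕ} (hL : 3 ≤ ell D) : alpha D < 1 / 2 := by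
  rw [alpha, bigP, Real.log_exp]
  have h9 : (3 : ℝ) ^ 9 ≤ ell D ^ 9 := pow_le_pow_left₀ (by norm_num) hL 9
  rw [div_lt_iff₀ (by positivity)]
  nlinarith [Real.pi_lt_four]

end WithCharacter

/-- **`Section4.Shift47` HOLDS** (threshold `D ≥ ⌈e³⌉`): the contour of
`(2πi)⁻¹∫_{(−σ−1/2)} Z̃(s+w)F(1−s−w,ψ̄)P^{(9/5)w}ω₁(w)dw/w` is moved to `Re w = 10` inside
`|Im w| < 𝓛²⁰`, across the simple pole at `w = 0` whose residue is `Z̃(s,ψ)F(1−s,ψ̄)`.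
[cite: Zhang2022LandauSiegel, §4 (4.7) (proof) p. 20] -/
theorem shift47_holds : Shift47 := by
  refine ⟨⌈Real.exp 3⌉₊, fun D _ χ hD _ _ x s hs => ?_⟩
  have hL3 : 3 ≤ ell D := three_le_ell' hD
  have hL0 : 0 < ell D := by linarith
  have hα : alpha D < 1 / 2 := alpha_lt_half' hL3
  have hs1 : 1 / 2 - alpha D < s.re := hs.1
  have ha : -s.re - 1 / 2 < 0 := by linarith
  have hV : 0 < ell D ^ 20 := pow_pos hL0 20
  have him : ell D ^ 20 < s.im := ell_pow_lt_im_of_mem_Omega3 hL3 hs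
  have hres : f47 χ x s 0 = tildeZW χ x s * FpolyBar χ x (1 - s) := by
    simp [f47]
  rw [← hres]
  refine perronLine_eq_contour_sub (f47 χ x s) ha (by norm_num) hV ?_
    (integrable_perronIntegrand_f47 χ x hL0 hs hα)
  intro w hw
  have hwim : -(ell D ^ 20) ≤ w.im := hw.2.1
  have hpos : 0 < (s + w).im := by rw [Complex.add_im]; linarith
  exact (differentiableAt_perronNumerator (differentiableAt_f47 χ x s w hpos)).differentiableWithinAt

/-- **`Section4.Shift48` HOLDS** (threshold `D ≥ ⌈e³⌉`): the contour of the (4.8)-integral is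
moved to `Re w = −α` inside `|Im w| < 𝓛²⁰`; no pole is crossed (`Re w ≤ −α < 0` throughout).
[cite: Zhang2022LandauSiegel, §4 (4.8) (proof) p. 20] -/
theorem shift48_holds : Shift48 := by
  refine ⟨⌈Real.exp 3⌉₊, fun D _ χ hD _ _ x s hs => ?_⟩
  have hL3 : 3 ≤ ell D := three_le_ell' hD
  have hL0 : 0 < ell D := by linarith
  have hα : alpha D < 1 / 2 := alpha_lt_half' hL3
  have hαpos : 0 < alpha D := by
    rw [alpha, bigP, Real.log_exp]; positivity
  have hs1 : 1 / 2 - alpha D < s.re := hs.1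
  have hV : 0 < ell D ^ 20 := pow_pos hL0 20
  have him : ell D ^ 20 < s.im := ell_pow_lt_im_of_mem_Omega3 hL3 hs
  refine perronLine_eq_contour (f48 χ x s) ?_ (integrable_perronIntegrand_f48 χ x hL0 hs hα)
  intro w hw
  have hwre : w.re ≤ -alpha D := by
    have h := hw.1
    rw [Set.uIcc_of_le (by linarith : -s.re - 1 / 2 ≤ -alpha D)] at h
    exact h.2
  have hwim : -(ell D ^ 20) ≤ w.im := by
    have h := hw.2
    rw [Set.uIcc_of_le (by linarith : -(ell D ^ 20) ≤ ell D ^ 20)] at h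
    exact h.1
  have hw0 : w ≠ 0 := fun h => by rw [h, Complex.zero_re] at hwre; linarith
  have hpos : 0 < (s + w).im := by rw [Complex.add_im]; linarith
  exact (differentiableAt_perronIntegrand (differentiableAt_f48 χ x s w hpos) hw0).differentiableWithinAt

end Literature.NumberTheory.LFunctions.Zhang2022.Section4
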